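import Summits.ResolutionOfSingularities.ResolutionOfSingularities.Theorems.MarkedTransferCampaignW46ThreefoldsRegime
import HarnessLib

/-!
# [OURS · L1 W4.6 rung (ii)] The reductions re-derived from the 0-PADDED / MONOTONE off-centre shapes
# (`OffCentreLocalPad`, `OffCentreMonotone`, Threefolds.lean v4) — answer to OURS-DESK #38 (proofs)

Cell res-hironaka, LADDER-RESOLUTION rung L (D-0089), slot W4.6, rung (ii); seat res-L1-s46-pv-3 (gen 2). Host route
MarkedTransfer, host item `HypersurfaceOrderReductionDimLeThree` (stmt-16156); `--kind proof --supports` it.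

HONEST FRAMING. Everything below is OURS: pure logic over the campaign shapes plus the tree's order theory
(`Hironaka2017.InvStringOrder`) and topology; NOTHING here is a statement of H. Hironaka's manuscript (2017-03-23,
[Hironaka2017]) and nothing asserts that any statement of it holds. All shapes are HYPOTHESES. AI review is weaker than
expert review.

## Why (OURS-DESK #38, lanes A res-L1-ref-a3 00:40:02Z / B res-L1-ref-b1 00:42:49Z, concordant PARTIAL)

`OffCentreLocal` compares `Inv`-strings off the centre by LIST equality and so forces `m′ = m` at every admitted step with a
closed point off the centre — beyond the printed role (Eq. (34) p.24 locality; «`m′ ≤ m` … adding (0) repeatedly» p.84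
l.17–20; «the chain is made shorter and shorter» §16.3 p.87 l.22–23). This module (i) records the kernel fact behind the
honest note of Threefolds.lean v4: padded equality STILL forces equal lengths when `n ≥ 1` (`length_eq_of_padKey_eq`,
from `InvStringOrder.zero_lt_key`), so the lanes' diff `OffCentreLocalPad` is only nominally weaker; (ii) proves the
implications `OffCentreLocal → OffCentreLocalPad → OffCentreMonotone`; (iii) re-derives the WHOLE-∇ reduction from the
strictly weaker MONOTONE shape («nothing gets worse off the centre») plus `StopsMonotone` for the lengths — compatible
with `m′ < m`. The COMPONENT-WISE (∇-centred, registered) reduction from `OffCentreLocalPad` + `StopsMonotone` — exactly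
as the lanes asked — is the companion module `MarkedTransferCampaignW46ThreefoldsPaddedNabla`; the component-wise
reduction from the MONOTONE shape needs a different measure (the de Jong component count is not monotone under inclusion
of terminal plats) and is in neither file.

## Contents

* order plumbing: `padFin_congr`, `lexLT_congr_left/right`, `length_eq_of_padKey_eq`, `lexLT_of_not_lexLT_of_lexLT`;
* `offCentreLocalPad_of_offCentreLocal`, `offCentreMonotone_of_offCentreLocalPad` (+ antitonicity, regime-(ii) instances);
* whole-∇: `Step.descent_of_whole_mono`, `terminatesWhole_of_decrease_mono` (`DecreaseAlongSteps → StopsMonotone →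
  NablaTopSing → OffCentreMonotone → TerminatesWhole`), `terminatesWhole_of_thm16_6_mono`, rung (ii)
  `terminatesWholeII_of_decrease_mono`.

References: Threefolds.lean v4 (p481395); reductions p472064, p475765, p477213; regime p480316; shared module v3
(p468540) + anchors v2 (p468263). F. Baader, T. Nipkow, *Term Rewriting and All That*, §2.4 (lexicographic orders) —
through the tree's `InvStringOrder` [BaaderNipkow1998]. H. Hironaka, ms. 2017-03-23, Th. 16.6 p.84 l.4–32, §16.3 p.87
l.10–28, Eq. (34) p.24 — scope only, under adjudication, not cited as fact. [Hironaka2017]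
-/

noncomputable section

set_option linter.dupNamespace false -- mandated namespace of this single-conjunct summit

open CategoryTheory AlgebraicGeometry TopologicalSpace

namespace Summit.ResolutionOfSingularities.ResolutionOfSingularities.Theorems

namespace CampaignW46

open Literature.AlgebraicGeometry.Resolution
open Literature.AlgebraicGeometry.Hironaka2017
open Literature.AlgebraicGeometry.Hironaka2017.S02Preliminaries
open Literature.AlgebraicGeometry.Hironaka2017.Datum
open Literature.AlgebraicGeometry.Hironaka2017.S15ARSchemes
open Literature.AlgebraicGeometry.Hironaka2017.S16Proof
open Literature.AlgebraicGeometry.Hironaka2017.InvStringOrder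

universe u

variable {n : ℕ} {p : ℕ} [Fact p.Prime] {K : Type u} [Field K] [CharP K p]

/-! ## Order plumbing: padded encodings see only the padded entries -/

/-- Strings with the same 0-padded entries have the same padded encoding into any number of slots. [folklore] -/
theorem padFin_congr (M : ℕ) {L₁ L₂ : List (EdgeInv n)} (h : ∀ j, InvString.padKey L₁ j = InvString.padKey L₂ j) :
    padFin M L₁ = padFin M L₂ := by
  unfold padFin
  congr 1
  funext i
  exact h i.val

/-- `LexLT` only consults the padded entries (left argument). [folklore] -/
theorem lexLT_congr_left {L₁ L₂ L : List (EdgeInv n)} (h : ∀ j, InvString.padKey L₁ j = InvString.padKey L₂ j) :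
    InvString.LexLT L₁ L ↔ InvString.LexLT L₂ L := by
  constructor
  · rintro ⟨i, hi, hlt⟩
    exact ⟨i, fun j hj => (h j).symm.trans (hi j hj), (h i) ▸ hlt⟩
  · rintro ⟨i, hi, hlt⟩
    exact ⟨i, fun j hj => (h j).trans (hi j hj), (h i).symm ▸ hlt⟩

/-- `LexLT` only consults the padded entries (right argument). [folklore] -/
theorem lexLT_congr_right {L₁ L₂ L : List (EdgeInv n)} (h : ∀ j, InvString.padKey L₁ j = InvString.padKey L₂ j) :
    InvString.LexLT L L₁ ↔ InvString.LexLT L L₂ := by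
  constructor
  · rintro ⟨i, hi, hlt⟩
    exact ⟨i, fun j hj => (hi j hj).trans (h j), (h i) ▸ hlt⟩
  · rintro ⟨i, hi, hlt⟩
    exact ⟨i, fun j hj => (hi j hj).trans (h j).symm, (h i).symm ▸ hlt⟩

/-- **THE HONEST NOTE OF Threefolds.lean v4, AS A THEOREM**: for `n ≥ 1` two strings with the same 0-padded entries have
the SAME LENGTH — every genuine entry has a key strictly above the padding key (tree `InvStringOrder.zero_lt_key`), so
the first padded position of the shorter string betrays it. Hence `OffCentreLocalPad` still forces `m′ = m` wherever it
bites; the substantively weaker shape is `OffCentreMonotone`. [folklore] -/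
theorem length_eq_of_padKey_eq (hn : 1 ≤ n) {L₁ L₂ : List (EdgeInv n)}
    (h : ∀ j, InvString.padKey L₁ j = InvString.padKey L₂ j) : L₁.length = L₂.length := by
  by_contra hne
  wlog hlt : L₁.length < L₂.length generalizing L₁ L₂
  · exact this (fun j => (h j).symm) (Ne.symm hne) (lt_of_le_of_ne (not_lt.mp hlt) (Ne.symm hne))
  have h1 : InvString.padKey L₁ L₁.length = toLex fun _ => 0 := padKey_of_length_le L₁ le_rfl
  have h2 : InvString.padKey L₂ L₁.length = (L₂[L₁.length]).key := padKey_of_lt L₂ hlt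
  have hpos := zero_lt_key hn (L₂[L₁.length])
  rw [← h2, ← h L₁.length, h1] at hpos
  exact lt_irrefl _ hpos

/-- «not above, then strictly below something» composes: if `L₁` is not strictly above `L₂` and `L₂ <_lex L₃` then
`L₁ <_lex L₃` (the padded comparison is a linear preorder: encode into `max` of the lengths slots). [folklore] -/
theorem lexLT_of_not_lexLT_of_lexLT {L₁ L₂ L₃ : List (EdgeInv n)} (h₁₂ : ¬ InvString.LexLT L₂ L₁)
    (h₂₃ : InvString.LexLT L₂ L₃) : InvString.LexLT L₁ L₃ := by
  set M := max (max L₁.length L₂.length) L₃.length with hM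
  have h1 : L₁.length ≤ M := (le_max_left _ _).trans (le_max_left _ _)
  have h2 : L₂.length ≤ M := (le_max_right _ _).trans (le_max_left _ _)
  have h3 : L₃.length ≤ M := le_max_right _ _
  rw [lexLT_iff_padFin_lt h2 h1, not_lt] at h₁₂
  rw [lexLT_iff_padFin_lt h2 h3] at h₂₃
  exact (lexLT_iff_padFin_lt h1 h3).mpr (h₁₂.trans_lt h₂₃)

/-! ## The three off-centre shapes compared -/

section Shapes

variable {N : Notions.{u} n} {Rd : Reading p K N} {Rg Rg₁ Rg₂ : Regime p K}

/-- `OffCentreLocal → OffCentreLocalPad` (list equality gives equal padded entries). [folklore] -/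
theorem offCentreLocalPad_of_offCentreLocal (h : OffCentreLocal N Rd Rg) : OffCentreLocalPad N Rd Rg :=
  fun A E R hRg hRd A' s R' hRd' ξ' hξ' hD j => by rw [h A E R hRg hRd A' s R' hRd' ξ' hξ' hD]

/-- `OffCentreLocalPad → OffCentreMonotone` (equal padded entries are not strictly comparable). [folklore] -/
theorem offCentreMonotone_of_offCentreLocalPad (h : OffCentreLocalPad N Rd Rg) : OffCentreMonotone N Rd Rg :=
  fun A E R hRg hRd A' s R' hRd' ξ' hξ' hD hlt =>
    lexLT_irrefl _ ((lexLT_congr_right (h A E R hRg hRd A' s R' hRd' ξ' hξ' hD)).mp hlt)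

/-- Pure logic: enlarging the regime strengthens `OffCentreLocalPad`. [folklore] -/
theorem offCentreLocalPad_antitone (hle : ∀ A E, Rg₁ A E → Rg₂ A E) (h : OffCentreLocalPad N Rd Rg₂) :
    OffCentreLocalPad N Rd Rg₁ :=
  fun A E R h₁ hRd A' s R' hR' => h A E R (hle A E h₁) hRd A' s R' hR'

/-- Pure logic: enlarging the regime strengthens `OffCentreMonotone`. [folklore] -/
theorem offCentreMonotone_antitone (hle : ∀ A E, Rg₁ A E → Rg₂ A E) (h : OffCentreMonotone N Rd Rg₂) :
    OffCentreMonotone N Rd Rg₁ :=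
  fun A E R h₁ hRd A' s R' hR' => h A E R (hle A E h₁) hRd A' s R' hR'

/-- Rung (ii) instances: `OffCentreLocalII → OffCentreLocalPadII → OffCentreMonotoneII`. [folklore] -/
theorem offCentreMonotoneII_of_offCentreLocalII (N : Notions.{u} n) (Rd : Reading p K N) :
    (OffCentreLocalII N Rd → OffCentreLocalPadII N Rd) ∧ (OffCentreLocalPadII N Rd → OffCentreMonotoneII N Rd) :=
  ⟨offCentreLocalPad_of_offCentreLocal, offCentreMonotone_of_offCentreLocalPad⟩

end Shapes

/-! ## The whole-∇ reduction from the MONOTONE shape -/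

section WholeMono

variable {N : Notions.{u} n} {Rd : Reading p K N} {Rg : Regime p K}
variable {A A' : AmbientDatum p K} {E : IdealExponent A.Z} {R : Resume N A E}

/-- THE ONE-STEP DESCENT for a whole step (`D = ∇(E)`) under the monotone off-centre shape: at every closed `η′ ∈ ∇(E′)`
the string of `R′` is strictly below the top string of `R`, and `m′ ≤ m`. Over the centre: `D′ = ∅`, Eq. (127). Off the
centre: `π η′` is a closed point of `Sing(E) ∖ ∇(E)`, so its string is strictly below the top (T2-Sing), and the string
upstairs is not above it (`OffCentreMonotone`) — compose (`lexLT_of_not_lexLT_of_lexLT`); `m′ ≤ m` is `StopsMonotone`.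
[folklore] -/
theorem Step.descent_of_whole_mono (hD : DecreaseAlongSteps N Rd Rg) (hM : StopsMonotone N Rd Rg)
    (hL : OffCentreMonotone N Rd Rg) (hRg : Rg A E) (hRd : Rd A E R) (s : Step R A')
    (hwhole : (s.D : Set A.Z) = (R.nabla : Set A.Z)) {η : A.Z}
    (hT1 : ∀ ξ : A.Z, ξ ∈ Literature.AlgebraicGeometry.Hironaka2017.S02Preliminaries.closedPoints A.Z →
      ξ ∈ (R.nabla : Set A.Z) → R.invStr ξ = R.invStr η)
    (hT2 : ∀ ξ : A.Z, ξ ∈ Literature.AlgebraicGeometry.Hironaka2017.S02Preliminaries.closedPoints A.Z →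
      ξ ∈ E.sing → ξ ∉ (R.nabla : Set A.Z) → InvString.LexLT (R.invStr ξ) (R.invStr η))
    {E' : IdealExponent A'.Z} (hE' : E' = s.E') (R' : Resume N A' E') (hRd' : Rd A' E' R') {η' : A'.Z}
    (hη'n : η' ∈ (R'.nabla : Set A'.Z))
    (hη' : η' ∈ Literature.AlgebraicGeometry.Hironaka2017.S02Preliminaries.closedPoints A'.Z) :
    InvString.LexLT (R'.invStr η') (R.invStr η) ∧ R'.m ≤ R.m := by
  subst hE'
  have hζ := s.apply_mem_closedPoints hη'
  have hζs : s.π η' ∈ E.sing := s.apply_mem_sing (R'.nabla_subset_sing hη'n)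
  refine ⟨?_, hM A E R hRg hRd A' s R' hRd'⟩
  by_cases hD' : s.π η' ∈ (s.D : Set A.Z)
  · have hstep := hD A E R hRg hRd A' s R' hRd'
    have hnot : η' ∉ R.mti.DPrime s.π s.D := by
      rw [s.dPrime_eq_empty_of_coe_eq hwhole]
      exact Set.notMem_empty _
    have h127 : Eq127 R.mti (s.π η') R'.mti η' := hstep.1 η' hη' hD' hnot
    have hin : s.π η' ∈ (R.nabla : Set A.Z) := by
      rw [← hwhole]
      exact hD'
    have e := hT1 _ hζ hin
    change InvString.LexLT (R'.invStr η') (R.invStr (s.π η')) at h127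
    rwa [e] at h127
  · have hmono := hL A E R hRg hRd A' s R' hRd' η' hη' hD'
    have hnot : s.π η' ∉ (R.nabla : Set A.Z) := by
      rw [← hwhole]
      exact hD'
    exact lexLT_of_not_lexLT_of_lexLT hmono (hT2 _ hζ hζs hnot)

/-- **WHOLE-∇ REDUCTION FROM THE MONOTONE SHAPE (general regime).** `DecreaseAlongSteps → StopsMonotone → NablaTopSing →
OffCentreMonotone → TerminatesWhole`: the top strings strictly decrease along a whole-∇ run and the numbers of stops are
bounded by `m₀`, so the tree's `eq127_no_infinite_descent_of_m_le` ends it. The off-centre hypothesis is only «nothing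
gets worse off the centre», compatible with `m′ < m`. [folklore] -/
theorem terminatesWhole_of_decrease_mono (hD : DecreaseAlongSteps N Rd Rg) (hM : StopsMonotone N Rd Rg)
    (hT : NablaTopSing N Rd Rg) (hL : OffCentreMonotone N Rd Rg) : TerminatesWhole N Rd Rg := by
  intro r hw hRg
  choose η hηn hηc hT1 hT2 using fun k => hT (r.A k) (r.E k) (r.R k) (hRg k) (r.reads k)
  have hstep : ∀ k, InvString.LexLT ((r.R (k + 1)).invStr (η (k + 1))) ((r.R k).invStr (η k)) ∧
      (r.R (k + 1)).m ≤ (r.R k).m :=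
    fun k => Step.descent_of_whole_mono hD hM hL (hRg k) (r.reads k) (r.step k) (hw k) (hT1 k) (hT2 k) (r.E_succ k)
      (r.R (k + 1)) (r.reads (k + 1)) (hηn (k + 1)) (hηc (k + 1))
  have hm : ∀ k, (r.R k).m ≤ (r.R 0).m := by
    intro k
    induction k with
    | zero => exact le_rfl
    | succ k ih => exact (hstep k).2.trans ih
  exact eq127_no_infinite_descent_of_m_le (r.R 0).m (fun k => (r.A k).Z) (fun k => (r.R k).mti) η
    (fun k => hm k) (fun k => (hstep k).1)

/-- The same with the one-step shape from the typed candidate `Thm16_6` (a HYPOTHESIS, via the anchor). [folklore] -/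
theorem terminatesWhole_of_thm16_6_mono [PerfectField K]
    {pPosiEmptyAt : ∀ {W : Scheme.{u}}, IdealExponent W → W → Prop}
    (h : Thm16_6 (p := p) (K := K) n (primeR N Rd) pPosiEmptyAt) (hM : StopsMonotone N Rd Rg)
    (hT : NablaTopSing N Rd Rg) (hL : OffCentreMonotone N Rd Rg) : TerminatesWhole N Rd Rg :=
  terminatesWhole_of_decrease_mono (decreaseAlongSteps_of_thm16_6 N Rd h Rg) hM hT hL

end WholeMono

/-! ## Rung (ii): the monotone whole-∇ form -/

section RungII

variable (N : Notions.{u} n) (Rd : Reading p K N)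

/-- RUNG (ii), whole-∇ form, MONOTONE off-centre shape: `DecreaseII → StopsMonotoneII → NablaTopSingII →
OffCentreMonotoneII → TerminatesWholeII`. [folklore] -/
theorem terminatesWholeII_of_decrease_mono (hD : DecreaseII N Rd) (hM : StopsMonotoneII N Rd)
    (hT : NablaTopSingII N Rd) (hL : OffCentreMonotoneII N Rd) : TerminatesWholeII N Rd :=
  terminatesWhole_of_decrease_mono hD hM hT hL

end RungII

end CampaignW46

end Summit.ResolutionOfSingularities.ResolutionOfSingularities.Theorems

end
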